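import Mathlib
import Summits.Ventures.PercRepro2.LocRows
import Summits.Ventures.PercRepro2.SwRow
import Summits.Ventures.PercRepro2.SwOut
import Summits.Ventures.PercRepro2.SwAllRow
import Summits.Ventures.PercRepro2.SwOutAll
import Summits.Ventures.PercRepro2.SwOutArmFlip
import Summits.Ventures.PercRepro2.SwOutArmThm
import Summits.Ventures.PercRepro2.SwOutJunction
import Summits.Ventures.PercRepro2.SwOutJunctionRegion
import Summits.Ventures.PercRepro2.SwOutCoreDefs
import Summits.Ventures.PercRepro2.SwOutCoreKey
import Summits.Ventures.PercRepro2.SwOutJunctionH1Defs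
import Summits.Ventures.PercRepro2.SwOutJunctionH1Arms
import Summits.Ventures.PercRepro2.SwOutJunctionH1Cover
import Summits.Ventures.PercRepro2.SwOutJunctionH1Inside
import Summits.Ventures.PercRepro2.SwOutJunctionH1Base
import Summits.Ventures.PercRepro2.SwOutJunctionH1Kinds
import Summits.Ventures.PercRepro2.SwOutBigBlockDefs
import Summits.Ventures.PercRepro2.SwOutMixedBaseDefs
import Summits.Ventures.PercRepro2.SwOutMixedBaseClasses
import Summits.Ventures.PercRepro2.SwOutMixedBaseHull
import Summits.Ventures.PercRepro2.SwOutMixedBaseDual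
import Summits.Ventures.PercRepro2.SwOutMixedCore
import Summits.Ventures.PercRepro2.SwOutMixedCoreClass
import Summits.Ventures.PercRepro2.SwOutMixedPartDefs
import Summits.Ventures.PercRepro2.SwOutMixedPartBase
import Summits.Ventures.PercRepro2.SwOutMixedPartCoreKey

/-!
# The key of the mixed kind is constant along the core points of its block (blind cell
PercRepro2, night-4 g19, 2026-08-27; proofs/NIGHT4-G19.md §5 (i))

For a core-kind `Q`-point `ζ` of a class with a mixed single junction whose canonical base
`b = coreBaseOf ζ` has blue dead edges (`mixedBase_of_coreKind`): the extended hull of `ζ` is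
`{h, u, p}` with the arms (`extHull_eq_of_coreKind`), so the region contains them
(`arms_subset_of_coreKind`); some u-arm exists (`uArms_nonempty_of_coreKind`: otherwise `u` is in
no cluster of `h`); the base agrees with the outside colouring off the region
(`coreBaseOf_agree`).  Hence for every CORE POINT `q` of the raw cube of `b` the realisation
`mixedReal b q` lies in the outside class (`mixedReal_core_mem_outClass`), is of the core kind
(`coreKind_mixedReal_core`), has the canonical base `b` (`coreBaseOf_mixedReal_core`), the
extended hull, the arms, the h-piece, the u-arms and the far arms of `ζ`
(`extHull_mixedReal_core`, `armsC_mixedReal_core`, `AhOf_mixedReal_core`, `uArms_mixedReal_core`,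
`farArms_mixedReal_core`) and blue dead edges at its base (`dead_blue_mixedReal_core`): the KEY
`(b, uArms ζ, AhOf ζ, farArms ζ)` of the mixed kind is constant along the core points of the block.
-/

namespace Summit.Ventures.PercRepro2

namespace BigBlock

open Hull LocRows

variable {V : Type*} {E : Type*} [Fintype E] [DecidableEq E]

open scoped Classical

variable {ends : E → Sym2 V} {U : Set V} {ξ : Config E} {l h o u p : V}

variable (hj : MixedJunction ends U h u p o)
include hj

omit [DecidableEq E] in
/-- The extended hull of a configuration is `{h, u, p}` with the arms. -/
lemma extHull_eq_arms (ζ : Config E) :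
    extHull ends ζ h u = {h} ∪ {u} ∪ {p} ∪ armsAll (fun P : uArms ends h u p ζ => P.1)
      (AhOf ends h u p ζ) (fun P : farArms ends h u p ζ => P.1) := by
  apply Set.Subset.antisymm
  · intro x hxH
    by_cases hxh : x = h
    · exact Or.inl (Or.inl (Or.inl hxh))
    by_cases hxu : x = u
    · exact Or.inl (Or.inl (Or.inr hxu))
    rcases arm_cases hj hxH hxh hxu with hx | hx | ⟨P, hP, hx⟩ | ⟨P, hP, hx⟩
    · exact Or.inr (Or.inl (Or.inr hx))
    · exact Or.inl (Or.inr hx)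
    · exact Or.inr (Or.inl (Or.inl (Set.mem_iUnion.2 ⟨⟨P, hP⟩, hx⟩)))
    · exact Or.inr (Or.inr (Set.mem_iUnion.2 ⟨⟨P, hP⟩, hx⟩))
  · rintro x (((rfl | rfl) | rfl) | hx)
    · exact Or.inl (Or.inl (mem_cluster_self _ _ _))
    · exact Or.inr (Or.inl (mem_cluster_self _ _ _))
    · exact p_mem_extHull hj.hup ζ
    · exact (mem_extHull_of_mem_armsAll hj hx).1

/-- At a core-kind point the region contains `{h, u, p}` and the arms. -/
lemma arms_subset_of_coreKind {ζ : Config E} (hζ : ζ ∈ swOutSide ends l h o U ξ)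
    (hk : CoreKind ends U h u ζ) :
    {h} ∪ {u} ∪ {p} ∪ armsAll (fun P : uArms ends h u p ζ => P.1) (AhOf ends h u p ζ)
      (fun P : farArms ends h u p ζ => P.1) ⊆ U := by
  rw [← extHull_eq_arms hj ζ]
  exact extHull_subset_of_coreKind hζ hk

omit hj in
/-- The canonical base agrees with the outside colouring off the region (at a core-kind point
of the class). -/
lemma coreBaseOf_agree {ζ : Config E} (hζ : ζ ∈ swOutSide ends l h o U ξ)
    (hk : CoreKind ends U h u ζ) : ∀ e, e ∉ touches ends U → coreBaseOf ends ζ h u e = ξ e := by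
  intro e he
  have hHU : extHull ends ζ h u ⊆ U := extHull_subset_of_coreKind hζ hk
  have hnot : e ∉ touches ends (blueExt ends ζ h u) := by
    rintro ⟨x, hx, y, hxy⟩
    exact he ⟨x, hHU (blueExt_subset_extHull hx), y, hxy⟩
  unfold coreBaseOf
  rw [flip_apply_of_notMem hnot]
  exact (mem_outClass.1 (mem_swOutSide.1 hζ).2).1 e he

/-- **Some u-arm exists at a core-kind point** (with blue dead edges): otherwise `u` lies in no
cluster of `h`. -/
theorem uArms_nonempty_of_coreKind (hl : l ∉ U) {ζ : Config E}
    (hζ : ζ ∈ swOutSide ends l h o U ξ) (hk : CoreKind ends U h u ζ)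
    (hdead : ∀ e x, ends e = s(p, x) → x ∈ AhOf ends h u p ζ → coreBaseOf ends ζ h u e = false) :
    Nonempty (uArms ends h u p ζ) := by
  by_contra hne
  rw [not_nonempty_iff] at hne
  have hb := mixedBase_of_coreKind hj hl hζ hk hdead
  have hq : Core (qOf ends h u p ζ) := ⟨rfl, rfl⟩
  have hζ' := mixedReal_coreBaseOf hj hl hζ hk
  have hu := hk.1
  rw [← hζ'] at hu
  have hno : ∀ q' : Pt (uArms ends h u p ζ) (farArms ends h u p ζ),
      u ∉ redSetM h u p (fun P : uArms ends h u p ζ => P.1) (AhOf ends h u p ζ)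
        (fun P : farArms ends h u p ζ => P.1) q' := by
    intro q' hu'
    rw [mem_redSetM_iff] at hu'
    rcases hu' with hu' | ⟨j, _, _⟩ | ⟨_, j, _⟩ | ⟨hu', _⟩ | ⟨_, hu'⟩ | ⟨k, _, hu'⟩
    · exact hj.hne_hu hu'.symm
    · exact hne.elim j
    · exact hne.elim j
    · exact hj.hne_up hu'
    · exact hb.u_notMem_Ah hu'
    · exact hb.u_notMem_F k hu'
  rcases hu with hu | hu
  · rw [hb.cluster_mixedReal hj.hup (not_leakR_of_core hq)] at hu
    exact hno _ hu
  · rw [hb.cluster_blue_mixedReal hj.hup (not_leakB_of_core hq)] at hu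
    exact hno _ hu

section CorePoints

variable (hl : l ∉ U) {ζ : Config E} (hζ : ζ ∈ swOutSide ends l h o U ξ)
  (hk : CoreKind ends U h u ζ)
  (hdead : ∀ e x, ends e = s(p, x) → x ∈ AhOf ends h u p ζ → coreBaseOf ends ζ h u e = false)
  {q : Pt (uArms ends h u p ζ) (farArms ends h u p ζ)} (hq : Core q)
include hl hζ hk hdead hq

/-- The realisation of a core point lies in the outside class. -/
theorem mixedReal_core_mem_outClass :
    mixedReal ends u p (fun P : uArms ends h u p ζ => P.1) (AhOf ends h u p ζ)
      (fun P : farArms ends h u p ζ => P.1) (coreBaseOf ends ζ h u) q ∈ outClass ends U h ξ :=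
  (mixedBase_of_coreKind hj hl hζ hk hdead).mixedReal_mem_outClass hj.hup
    (arms_subset_of_coreKind hj hζ hk) (coreBaseOf_agree hζ hk) (not_leakR_of_core hq)
    (not_leakB_of_core hq)

/-- The realisation of a core point is of the core kind. -/
theorem coreKind_mixedReal_core :
    CoreKind ends U h u (mixedReal ends u p (fun P : uArms ends h u p ζ => P.1)
      (AhOf ends h u p ζ) (fun P : farArms ends h u p ζ => P.1) (coreBaseOf ends ζ h u) q) :=
  haveI := uArms_nonempty_of_coreKind hj hl hζ hk hdead
  (mixedBase_of_coreKind hj hl hζ hk hdead).coreKind_core hj.hup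
    (arms_subset_of_coreKind hj hζ hk) hq

/-- The canonical base of the realisation of a core point is the base. -/
theorem coreBaseOf_mixedReal_core :
    coreBaseOf ends (mixedReal ends u p (fun P : uArms ends h u p ζ => P.1)
      (AhOf ends h u p ζ) (fun P : farArms ends h u p ζ => P.1) (coreBaseOf ends ζ h u) q) h u =
      coreBaseOf ends ζ h u :=
  (mixedBase_of_coreKind hj hl hζ hk hdead).coreBaseOf_core hj.hup hq

/-- The extended hull of the realisation of a core point is that of `ζ`. -/
theorem extHull_mixedReal_core :
    extHull ends (mixedReal ends u p (fun P : uArms ends h u p ζ => P.1)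
      (AhOf ends h u p ζ) (fun P : farArms ends h u p ζ => P.1) (coreBaseOf ends ζ h u) q) h u =
      extHull ends ζ h u := by
  haveI := uArms_nonempty_of_coreKind hj hl hζ hk hdead
  rw [(mixedBase_of_coreKind hj hl hζ hk hdead).extHull_core hj.hup hq, extHull_eq_arms hj ζ]

/-- The arms of the realisation of a core point are those of `ζ`. -/
theorem armsC_mixedReal_core :
    armsC ends h u (mixedReal ends u p (fun P : uArms ends h u p ζ => P.1)
      (AhOf ends h u p ζ) (fun P : farArms ends h u p ζ => P.1) (coreBaseOf ends ζ h u) q) =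
      armsC ends h u ζ :=
  armsC_eq_of_extHull_eq (extHull_mixedReal_core hj hl hζ hk hdead hq)

/-- The arm of `p` at the realisation of a core point is that of `ζ`. -/
theorem armC_p_mixedReal_core :
    armC ends h u (mixedReal ends u p (fun P : uArms ends h u p ζ => P.1)
      (AhOf ends h u p ζ) (fun P : farArms ends h u p ζ => P.1) (coreBaseOf ends ζ h u) q) p =
      armC ends h u ζ p :=
  armC_eq_of_extHull_eq (extHull_mixedReal_core hj hl hζ hk hdead hq) p

/-- The h-piece of the realisation of a core point is that of `ζ`. -/
theorem AhOf_mixedReal_core :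
    AhOf ends h u p (mixedReal ends u p (fun P : uArms ends h u p ζ => P.1)
      (AhOf ends h u p ζ) (fun P : farArms ends h u p ζ => P.1) (coreBaseOf ends ζ h u) q) =
      AhOf ends h u p ζ := by
  have key : ∀ ζ₁ ζ₂ : Config E, armC ends h u ζ₁ p = armC ends h u ζ₂ p →
      AhOf ends h u p ζ₁ = AhOf ends h u p ζ₂ := by
    intro ζ₁ ζ₂ h2
    unfold AhOf
    rw [h2]
  exact key _ _ (armC_p_mixedReal_core hj hl hζ hk hdead hq)

/-- The u-arms of the realisation of a core point are those of `ζ`. -/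
theorem uArms_mixedReal_core :
    uArms ends h u p (mixedReal ends u p (fun P : uArms ends h u p ζ => P.1)
      (AhOf ends h u p ζ) (fun P : farArms ends h u p ζ => P.1) (coreBaseOf ends ζ h u) q) =
      uArms ends h u p ζ := by
  have key : ∀ ζ₁ ζ₂ : Config E, armsC ends h u ζ₁ = armsC ends h u ζ₂ →
      armC ends h u ζ₁ p = armC ends h u ζ₂ p → uArms ends h u p ζ₁ = uArms ends h u p ζ₂ := by
    intro ζ₁ ζ₂ h1 h2
    unfold uArms
    rw [h1, h2]
  exact key _ _ (armsC_mixedReal_core hj hl hζ hk hdead hq)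
    (armC_p_mixedReal_core hj hl hζ hk hdead hq)

/-- The far arms of the realisation of a core point are those of `ζ`. -/
theorem farArms_mixedReal_core :
    farArms ends h u p (mixedReal ends u p (fun P : uArms ends h u p ζ => P.1)
      (AhOf ends h u p ζ) (fun P : farArms ends h u p ζ => P.1) (coreBaseOf ends ζ h u) q) =
      farArms ends h u p ζ := by
  have key : ∀ ζ₁ ζ₂ : Config E, armsC ends h u ζ₁ = armsC ends h u ζ₂ →
      armC ends h u ζ₁ p = armC ends h u ζ₂ p → farArms ends h u p ζ₁ = farArms ends h u p ζ₂ := by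
    intro ζ₁ ζ₂ h1 h2
    unfold farArms
    rw [h1, h2]
  exact key _ _ (armsC_mixedReal_core hj hl hζ hk hdead hq)
    (armC_p_mixedReal_core hj hl hζ hk hdead hq)

/-- The dead edges are blue at the canonical base of the realisation of a core point. -/
theorem dead_blue_mixedReal_core :
    ∀ e x, ends e = s(p, x) →
      x ∈ AhOf ends h u p (mixedReal ends u p (fun P : uArms ends h u p ζ => P.1)
        (AhOf ends h u p ζ) (fun P : farArms ends h u p ζ => P.1) (coreBaseOf ends ζ h u) q) →
      coreBaseOf ends (mixedReal ends u p (fun P : uArms ends h u p ζ => P.1)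
        (AhOf ends h u p ζ) (fun P : farArms ends h u p ζ => P.1) (coreBaseOf ends ζ h u) q) h u
        e = false := by
  intro e x hxe hx
  rw [AhOf_mixedReal_core hj hl hζ hk hdead hq] at hx
  rw [coreBaseOf_mixedReal_core hj hl hζ hk hdead hq]
  exact hdead e x hxe hx

end CorePoints

end BigBlock

end Summit.Ventures.PercRepro2
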